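import Literature.Computability.Complexity.StringSwap
import HarnessLib

/-!
# Pair plumbing in `FP`: unary normalisation and machines with a unary argument

Trunk `CplxCore`, toolkit for `TimeBounds.lean` (continuing `StringCopy.lean`, `StringSwap.lean`,
`MapFstMachine.lean`, `PairingMachines.lean` — whose total re-pairing
`rePair w = ⟨(boolUnpair w).1, (boolUnpair w).2⟩` is used here; re-association
`⟨⟨a, b⟩, c⟩ ↦ ⟨a, ⟨b, c⟩⟩` is `Literature.Computability.Complexity.assocFn` of `CountingHierarchyPPoly.lean`): small
polynomial-time string functions / transports that recur when a reduction is assembled from `FP`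
bricks around a given polynomial-time machine.

* `onesFn w = 1^{|w|}` (`= unaryEncodeNat (unaryDecodeNat w)`, a one-state transducer,
  `onesFn_mem_FP`).
* `mem_FP_of_unaryArg`: a function `f : {0,1}* × ℕ → β` that is polynomial-time on the
  presentation `⟨w, 1ᵗ⟩` (the convention of `Literature.Computability.MetaComplexity.UniversalMachine.polyTime`: time budget
  in unary) yields the `FP` string function `w ↦ eb (f (boolUnpair w).1 |(boolUnpair w).2|)`
  (normalise the second component to `1^{|·|}`, then compose, `PolyTimeComputable.comp_holds`).

## References

* S. Arora, B. Barak, *Computational Complexity: A Modern Approach*, CUP 2009, §0.1 (pairing),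
  §1.3 and Thm. 2.8 (composition of polynomial-time machines).
-/

namespace Literature.Computability.Complexity

open _root_.Computability

/-! ### Unary normalisation -/

/-- `onesFn w = 1^{|w|}`: the unary numeral of the length (`unaryDecodeNat = List.length`). [folklore] -/
def onesFn (w : List Bool) : List Bool := unaryEncodeNat w.length

/-- `onesFn w = unaryEncodeNat (unaryDecodeNat w)`. [folklore] -/
theorem onesFn_eq (w : List Bool) : onesFn w = unaryEncodeNat (unaryDecodeNat w) := rfl

/-- Length of `onesFn w` (`unaryDecodeNat` is `List.length`). [folklore] -/
@[simp] theorem length_onesFn (w : List Bool) : (onesFn w).length = w.length :=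
  unary_decode_encode_nat w.length

/-- The one-state transducer emitting `1` per symbol. [folklore] -/
def onesFST : FST Unit Bool Bool where
  init := ()
  step _ _ := ((), [true])
  front _ := []
  keep _ := true

/-- The run of `onesFST`. [folklore] -/
theorem onesFST_run (z : List Bool) : onesFST.run () z = ((), onesFn z) := by
  induction z with
  | nil => rfl
  | cons b z ih => rw [FST.run_cons]; simp [onesFST] at ih ⊢; rw [ih]; rfl

/-- `onesFST` computes `onesFn`. [folklore] -/
theorem onesFST_eval : onesFST.eval = onesFn := by
  funext z
  rw [FST.eval, show onesFST.init = () from rfl, onesFST_run]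
  simp [onesFST]

/-- `onesFn ∈ FP`. [folklore] -/
theorem onesFn_mem_FP : onesFn ∈ FP := by
  rw [← onesFST_eval]; exact onesFST.polyTimeComputable_eval

/-! ### Machines with a unary numeric argument -/

/-- The normaliser `w ↦ ⟨(boolUnpair w).1, 1^{|(boolUnpair w).2|}⟩` (re-pair with `rePair` of
`PairingMachines.lean`, then `onesFn` on the second component). [folklore] -/
noncomputable def unaryArgFn : List Bool → List Bool := mapSndFn onesFn ∘ rePair

/-- `unaryArgFn ∈ FP`. [cite: AroraBarakCC2009, Thm. 2.8] -/
theorem unaryArgFn_mem_FP : unaryArgFn ∈ FP :=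
  comp_mem_FP (mapSndFn_mem_FP onesFn_mem_FP) rePair_mem_FP

/-- `unaryArgFn w = ⟨(boolUnpair w).1, unaryEncodeNat |(boolUnpair w).2|⟩` for every `w`. [folklore] -/
theorem unaryArgFn_apply (w : List Bool) :
    unaryArgFn w = boolPair (boolUnpair w).1 (unaryEncodeNat (boolUnpair w).2.length) := by
  simp [unaryArgFn, Function.comp_apply, rePair, mapSndFn_boolPair, onesFn]

/-- **A machine with a unary numeric argument yields an `FP` string function.** If
`f : {0,1}* × ℕ → β` is polynomial-time on inputs presented as `⟨w, 1ᵗ⟩` (e.g. the field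
`UniversalMachine.polyTime`), then `w ↦ eb (f (boolUnpair w).1 |(boolUnpair w).2|)` is in `FP`:
normalise the second component (`unaryArgFn`), then run the machine
(`PolyTimeComputable.comp_holds`). [cite: AroraBarakCC2009, Thm. 2.8] -/
theorem mem_FP_of_unaryArg {β : Type} {eb : β → List Bool} {f : List Bool → ℕ → β}
    (hf : PolyTimeComputable (fun q : List Bool × ℕ => boolPair q.1 (unaryEncodeNat q.2)) eb
      (Function.uncurry f)) :
    (fun w => eb (f (boolUnpair w).1 (boolUnpair w).2.length)) ∈ FP := by
  -- the argument map, presented through the machine's input encoder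
  have hg : PolyTimeComputable (id : List Bool → List Bool)
      (fun q : List Bool × ℕ => boolPair q.1 (unaryEncodeNat q.2))
      (fun w => ((boolUnpair w).1, (boolUnpair w).2.length)) := by
    obtain ⟨p, M, hM⟩ := unaryArgFn_mem_FP
    refine ⟨p, M, fun w => ?_⟩
    have h := hM w
    rwa [id, unaryArgFn_apply] at h
  obtain ⟨p, M, hM⟩ := PolyTimeComputable.comp_holds hf hg
  exact ⟨p, M, fun w => hM w⟩

end Literature.Computability.Complexity
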